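import Summits.BirchSwinnertonDyer.Rank1Residual.GaloisImage.CongruenceVisibilityIdentityComponentIndexRat
import Summits.BirchSwinnertonDyer.Rank1Residual.GaloisImage.CongruenceVisibilityIdentityComponentIndexGood
import Summits.BirchSwinnertonDyer.Rank1Residual.GaloisImage.TwoLagrangianLinesRelIndex
import HarnessLib

/-!
# THEOREM B's visible element for the D44-K STRAGGLERS: a second PAID place (rank-`3` partner) and a
# partner of GOOD reduction at `3`, seven-kind form (cell `b2b-bsdres`, team n1011, seat p10 GEN 9;
# ROW T-VIS3-UC-IOTA FILE 9; lead R5-102 (b)(i); skeleton `cells/n1011/skel/T-VIS3-UC-IOTA.md`)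

HONEST FRAMING (cell `b2b-bsdres`, run/shared/lean/b2b/bsd-rank1-residual/, verbatim in every
file): the goal of the cell is to DELETE the COMBINATION-SHAPED residual classes of the
Birch–Swinnerton-Dyer formula for ALL analytic-rank `≤ 1` elliptic curves over `ℚ` — "full BSD
formula for every rank `≤ 1` curve in class `C`" assembled STRICTLY from published theorems — so
that the rank-`≤ 1` remainder becomes exactly the CONSTRUCTION-SHAPED classes, which are TYPED
(missing-input `Prop`s), NOT attempted. This is not "finishing BSD". Team n1011 (N10 / N11):
research route on the CONSTRUCTION-SHAPED class X4 (§I N11 LOWER half); no claim beyond the stated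
classes; nothing is booked; no mark / label / count moved. Theorems only (no definition, no named
fact, no `sorry`). SOCKETS in the `hvis` currency, conditional on A40/A41 (`hU`/`hU2`) through the
multiplicative kinds; they CLOSE NOTHING by themselves — the records (p09 lineage) discharge `θ`, the
kinds, the local counts and the identity-component data; `hrank` is an EVIDENCE binder; p10 claims no
record and no row count (r1's: D44-K 186921e1 ← 479493a1, 434916b1 ← 16108c1, 465075bk1 ← 17225h1).

## What

The 25 E0/E0 rank-`2` D44-K rows elaborate against FILE 3's
`exists_sha_ne_zero_of_congr_of_identityComponent_of_rank_two_rat` with every place off `3` of one of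
the seven kinds (n1011-p04's `TwoLagrangianLines.relIndex_map_selmerLocalKer_eq_one_of_kind₇`). The
three stragglers need:
* `exists_sha_three_torsion_of_congr_of_identityComponent_of_rank_three_of_places₇_paidAt` — a
  rank-`3` partner and ONE more place `w₁ ∤ 3` that is PAID, not free: there
  `ι_{w₁}(θ) ≤ #𝓛_{w₁}(E′) = #E′(ℚ_{w₁})[3] ≤ 3` (`relIndex_map_selmerLocalKer_ne_zero_and_le`,
  `natCard_kummerLocalConditionAt_adicCompletion`, Milne I.3.3 at `w₁ ∤ 3`), so FILE 2/3's general
  budget reads `1 · 3 · 3 = 9 < 27 ≤ 3^{rank E′}` (`…_of_prod_lt_rat`);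
* `exists_sha_three_torsion_of_congr_of_identityComponent_of_hasGoodReductionAt_of_places₇` — the
  partner has GOOD reduction at `3` (FILE 5's `…_of_hasGoodReductionAt_of_rank_two_rat`), seven kinds
  elsewhere.
Rank-`0` X4 receivers then read `BSDp W 3` through n1011-p14's / p04's kind-agnostic `hvis`-ENDs.
References: [CremonaMazur2000] §3; [AgasheStein2002] Thm. 3.1, §3.5; [MilneADT2006] I.3.3, I.3.8;
[SilvermanATAEC1994] Ch. V; L41-NOTE §§1–2 (`HOME/b2b-bsdres-n1011-p10/g8/`). -/

set_option autoImplicit false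

noncomputable section

open scoped Classical NumberField
open IsDedekindDomain NumberField WeierstrassCurve Field Rat.HeightOneSpectrum
  Literature.NumberTheory.EllipticCurves Literature.NumberTheory.GaloisRepresentations

namespace Summit.BirchSwinnertonDyer.Rank1Residual.GaloisImage.TwistedWitness

/-- **`Ш(E)[3] ≠ 0` — receiver and partner σ = E0 at `v₀ = 3`, partner of rank `≥ 3`, ONE paid place
`w₁ ∈ S` (`w₁ ≠ v₀`, `w₁ ∤ 3`, `#E′(ℚ_{w₁})[3] ≤ 3`), every other place of `S` of one of the seven
kinds, `E(ℚ)` finite prime to `3`.** Budget `[E:3E]·3·ι_{w₁} ≤ 9 < 27` through FILE 3's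
`…_of_prod_lt_rat`. [cite: CremonaMazur2000, §3 and Table 1] [cite: AgasheStein2002, Thm. 3.1 and §3.5]
[cite: MilneADT2006, Ch. I Lemma 3.3 and Prop. 3.8] -/
theorem exists_sha_three_torsion_of_congr_of_identityComponent_of_rank_three_of_places₇_paidAt
    (hU : Silverman1994_thmV53_tateUniformisation.{0})
    (hU2 : Silverman1994_thmV53_corV54_tateUniformisation.{0})
    (W W' : WeierstrassCurve ℚ) [W.IsElliptic] [W'.IsElliptic]
    (θ : geomTorsion W' ((3 : ℕ) : ℤ) ≃+ geomTorsion W ((3 : ℕ) : ℤ))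
    (hθ : ∀ (σ : absoluteGaloisGroup ℚ) (P : geomTorsion W' ((3 : ℕ) : ℤ)), θ (σ • P) = σ • θ P)
    (S : Finset (HeightOneSpectrum (𝓞 ℚ)))
    (hS : ∀ v : HeightOneSpectrum (𝓞 ℚ), v ∉ S →
      W.HasGoodReductionAt v ∧ W'.HasGoodReductionAt v ∧ ((3 : ℕ) : 𝓞 ℚ) ∉ v.asIdeal)
    (hfin : Finite W.toAffine.Point) (hcop : (Nat.card W.toAffine.Point).Coprime 3)
    (hrank : 3 ≤ W'.mordellWeilRank)
    (v₀ : HeightOneSpectrum (𝓞 ℚ)) (hv₀ : (primesEquiv v₀ : ℕ) = 3)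
    (w₁ : HeightOneSpectrum (𝓞 ℚ)) (hw₁S : w₁ ∈ S) (hw₁ : w₁ ≠ v₀)
    (h3w₁ : ((3 : ℕ) : 𝓞 ℚ) ∉ w₁.asIdeal)
    (hcard₁ : Nat.card (nsmulAddMonoidHom 3 :
      (W'.baseChange (w₁.adicCompletion ℚ)).toAffine.Point →+ _).ker ≤ 3)
    (hplaces : ∀ w ∈ S, w ≠ v₀ → w ≠ w₁ →
      (((3 : ℕ) : 𝓞 ℚ) ∉ w.asIdeal ∧ Nat.card (nsmulAddMonoidHom 3 :
          (W'.baseChange (w.adicCompletion ℚ)).toAffine.Point →+ _).ker = 1) ∨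
      (W.HasSplitMultiplicativeReductionAt w ∧ W'.HasSplitMultiplicativeReductionAt w ∧
        Nat.card (nsmulAddMonoidHom 3 :
          (W.baseChange (w.adicCompletion ℚ)).toAffine.Point →+ _).ker ≤ 3) ∨
      (W.HasMultiplicativeReductionAt w ∧ W'.HasMultiplicativeReductionAt w ∧
        (∃ r : w.adicCompletion ℚ, algebraMap ℚ (w.adicCompletion ℚ) (-(W.c₄ / W.c₆)) =
          r ^ 2 * algebraMap ℚ (w.adicCompletion ℚ) (-(W'.c₄ / W'.c₆))) ∧
        (∀ ζ : w.adicCompletion ℚ, ζ ^ 3 = 1 → ζ = 1)) ∨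
      (W.HasMultiplicativeReductionAt w ∧
        ¬ IsSquare (algebraMap ℚ (w.adicCompletion ℚ) (-(W.c₄ / W.c₆))) ∧
        W'.HasGoodReductionAt w ∧ ((3 : ℕ) : 𝓞 ℚ) ∉ w.asIdeal) ∨
      (W.HasGoodReductionAt w ∧ W'.HasMultiplicativeReductionAt w ∧
        ¬ IsSquare (algebraMap ℚ (w.adicCompletion ℚ) (-(W'.c₄ / W'.c₆))) ∧
        ((3 : ℕ) : 𝓞 ℚ) ∉ w.asIdeal) ∨
      (1 < w.valuation ℚ W.j ∧ 1 < w.valuation ℚ W'.j ∧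
        (∃ r : w.adicCompletion ℚ, algebraMap ℚ (w.adicCompletion ℚ) (-(W.c₄ / W.c₆)) =
          r ^ 2 * algebraMap ℚ (w.adicCompletion ℚ) (-(W'.c₄ / W'.c₆))) ∧
        (∀ ζ : w.adicCompletion ℚ, ζ ^ 3 = 1 → ζ = 1)) ∨
      (W.HasAdditiveReductionAt w ∧ W'.HasAdditiveReductionAt w ∧ ((3 : ℕ) : 𝓞 ℚ) ∉ w.asIdeal ∧
        Nat.card (nsmulAddMonoidHom 3 :
          (W'.baseChange (w.adicCompletion ℚ)).toAffine.Point →+ _).ker = 3))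
    (hcard : Nat.card (nsmulAddMonoidHom 3 :
      (W.baseChange (v₀.adicCompletion ℚ)).toAffine.Point →+ _).ker = 3)
    (hcard' : Nat.card (nsmulAddMonoidHom 3 :
      (W'.baseChange (v₀.adicCompletion ℚ)).toAffine.Point →+ _).ker = 3)
    (M : WeierstrassCurve (v₀.adicCompletionIntegers ℚ)) (C : VariableChange (v₀.adicCompletion ℚ))
    (hC : C • W.baseChange (v₀.adicCompletion ℚ) =
      M.map (algebraMap (v₀.adicCompletionIntegers ℚ) (v₀.adicCompletion ℚ)))
    (x₀ y₀ a : IsLocalRing.ResidueField (v₀.adicCompletionIntegers ℚ))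
    (hcusp : M.map (IsLocalRing.residue (v₀.adicCompletionIntegers ℚ)) = singularModel x₀ y₀ a a)
    {a₀ b₀ : v₀.adicCompletionIntegers ℚ}
    (hns₀ : (M.map (IsLocalRing.residue (v₀.adicCompletionIntegers ℚ))).toAffine.Nonsingular
      (IsLocalRing.residue (v₀.adicCompletionIntegers ℚ) a₀)
      (IsLocalRing.residue (v₀.adicCompletionIntegers ℚ) b₀))
    (hm : ((M.map (algebraMap (v₀.adicCompletionIntegers ℚ) (v₀.adicCompletion ℚ))).baseChange
        (AlgebraicClosure (v₀.adicCompletion ℚ))).toAffine.Nonsingular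
      (algebraMap (v₀.adicCompletionIntegers ℚ) (AlgebraicClosure (v₀.adicCompletion ℚ)) a₀)
      (algebraMap (v₀.adicCompletionIntegers ℚ) (AlgebraicClosure (v₀.adicCompletion ℚ)) b₀))
    (h3 : (3 : ℤ) • (Affine.Point.some _ _ hm :
      ((M.map (algebraMap (v₀.adicCompletionIntegers ℚ) (v₀.adicCompletion ℚ))).baseChange
        (AlgebraicClosure (v₀.adicCompletion ℚ))).toAffine.Point) = 0)
    (M' : WeierstrassCurve (v₀.adicCompletionIntegers ℚ)) (C' : VariableChange (v₀.adicCompletion ℚ))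
    (hC' : C' • W'.baseChange (v₀.adicCompletion ℚ) =
      M'.map (algebraMap (v₀.adicCompletionIntegers ℚ) (v₀.adicCompletion ℚ)))
    (x₀' y₀' a' : IsLocalRing.ResidueField (v₀.adicCompletionIntegers ℚ))
    (hcusp' : M'.map (IsLocalRing.residue (v₀.adicCompletionIntegers ℚ)) = singularModel x₀' y₀' a' a')
    {a₀' b₀' : v₀.adicCompletionIntegers ℚ}
    (hns₀' : (M'.map (IsLocalRing.residue (v₀.adicCompletionIntegers ℚ))).toAffine.Nonsingular
      (IsLocalRing.residue (v₀.adicCompletionIntegers ℚ) a₀')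
      (IsLocalRing.residue (v₀.adicCompletionIntegers ℚ) b₀'))
    (hm' : ((M'.map (algebraMap (v₀.adicCompletionIntegers ℚ) (v₀.adicCompletion ℚ))).baseChange
        (AlgebraicClosure (v₀.adicCompletion ℚ))).toAffine.Nonsingular
      (algebraMap (v₀.adicCompletionIntegers ℚ) (AlgebraicClosure (v₀.adicCompletion ℚ)) a₀')
      (algebraMap (v₀.adicCompletionIntegers ℚ) (AlgebraicClosure (v₀.adicCompletion ℚ)) b₀'))
    (h3' : (3 : ℤ) • (Affine.Point.some _ _ hm' :
      ((M'.map (algebraMap (v₀.adicCompletionIntegers ℚ) (v₀.adicCompletion ℚ))).baseChange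
        (AlgebraicClosure (v₀.adicCompletion ℚ))).toAffine.Point) = 0) :
    ∃ c : W.sha, c ≠ 0 ∧ 3 • c = 0 := by
  haveI : Fact (Nat.Prime 3) := ⟨Nat.prime_three⟩
  haveI := hfin
  -- the comparison index at the paid place: `ι_{w₁}(θ) ≤ #𝓛_{w₁}(E′) = #E′(ℚ_{w₁})[3] · 1 ≤ 3`
  have hι₁ : (selmerLocalKer W (w₁.adicCompletion ℚ) ((3 : ℕ) : ℤ)).relIndex
      ((selmerLocalKer W' (w₁.adicCompletion ℚ) ((3 : ℕ) : ℤ)).map (h1Equiv θ hθ).toAddMonoidHom) ≤ 3 := by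
    refine (relIndex_map_selmerLocalKer_ne_zero_and_le W W' θ hθ w₁).2.trans ?_
    rw [W'.natCard_kummerLocalConditionAt_adicCompletion w₁ (by norm_num : (3 : ℕ) ≠ 0),
      natCard_quot_adicCompletionIntegers_eq_one (K := ℚ) (p := 3) h3w₁, mul_one]
    exact hcard₁
  -- every other place of `S ∖ v₀` has index `1`
  have hothers : ∀ w ∈ (S.erase v₀).erase w₁,
      (selmerLocalKer W (w.adicCompletion ℚ) ((3 : ℕ) : ℤ)).relIndex
        ((selmerLocalKer W' (w.adicCompletion ℚ) ((3 : ℕ) : ℤ)).map (h1Equiv θ hθ).toAddMonoidHom) = 1 := by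
    intro w hw
    have hw₁' : w ≠ w₁ := Finset.ne_of_mem_erase hw
    have hw' := Finset.mem_of_mem_erase hw
    exact TwoLagrangianLines.relIndex_map_selmerLocalKer_eq_one_of_kind₇ W W' hU hU2 (by norm_num) θ hθ
      (hplaces w (Finset.mem_of_mem_erase hw') (Finset.ne_of_mem_erase hw') hw₁')
  refine exists_sha_ne_zero_of_congr_of_identityComponent_of_prod_lt_rat W W' θ hθ S hS v₀ hv₀ ?_ hcard
    hcard' M C hC x₀ y₀ a hcusp hns₀ hm h3 M' C' hC' x₀' y₀' a' hcusp' hns₀' hm' h3'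
  have hw₁e : w₁ ∈ S.erase v₀ := Finset.mem_erase.mpr ⟨hw₁, hw₁S⟩
  have hprod : ∏ v ∈ S.erase v₀, (selmerLocalKer W (v.adicCompletion ℚ) ((3 : ℕ) : ℤ)).relIndex
      ((selmerLocalKer W' (v.adicCompletion ℚ) ((3 : ℕ) : ℤ)).map (h1Equiv θ hθ).toAddMonoidHom) ≤ 3 := by
    rw [← Finset.mul_prod_erase _ _ hw₁e, Finset.prod_eq_one hothers, mul_one]
    exact hι₁
  rw [index_range_zsmul_eq_one_of_coprime hcop, one_mul]
  calc _ ≤ 3 * 3 := Nat.mul_le_mul_left 3 hprod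
    _ < 3 ^ 3 := by norm_num
    _ ≤ 3 ^ W'.mordellWeilRank := Nat.pow_le_pow_right (by norm_num) hrank
    _ ≤ _ := by convert pow_mordellWeilRank_le_index_range_zsmul W' (n := 3) (by norm_num)

/-- **`Ш(E)[3] ≠ 0` — receiver σ = E0 (additive, cusp datum), partner of GOOD reduction at `v₀ = 3`
with `#E′(ℚ₃)[3] = 3`, rank `≥ 2`, every other place of `S` of one of the seven kinds, `E(ℚ)` finite
prime to `3`** (FILE 5's `…_of_hasGoodReductionAt_of_rank_two_rat` with kind ⇒ `ι_w(θ) = 1`).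
[cite: CremonaMazur2000, §3 and Table 1] [cite: MilneADT2006, Ch. I Prop. 3.8 and Lemma 3.3]
[cite: SilvermanATAEC1994, Ch. V Thm. 3.1, Lemma 5.2, Thm. 5.3, Cor. 5.4] -/
theorem exists_sha_three_torsion_of_congr_of_identityComponent_of_hasGoodReductionAt_of_places₇
    (hU : Silverman1994_thmV53_tateUniformisation.{0})
    (hU2 : Silverman1994_thmV53_corV54_tateUniformisation.{0})
    (W W' : WeierstrassCurve ℚ) [W.IsElliptic] [W'.IsElliptic]
    (θ : geomTorsion W' ((3 : ℕ) : ℤ) ≃+ geomTorsion W ((3 : ℕ) : ℤ))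
    (hθ : ∀ (σ : absoluteGaloisGroup ℚ) (P : geomTorsion W' ((3 : ℕ) : ℤ)), θ (σ • P) = σ • θ P)
    (S : Finset (HeightOneSpectrum (𝓞 ℚ)))
    (hS : ∀ v : HeightOneSpectrum (𝓞 ℚ), v ∉ S →
      W.HasGoodReductionAt v ∧ W'.HasGoodReductionAt v ∧ ((3 : ℕ) : 𝓞 ℚ) ∉ v.asIdeal)
    (hfin : Finite W.toAffine.Point) (hcop : (Nat.card W.toAffine.Point).Coprime 3)
    (hrank : 2 ≤ W'.mordellWeilRank)
    (v₀ : HeightOneSpectrum (𝓞 ℚ)) (hv₀ : (primesEquiv v₀ : ℕ) = 3)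
    (hplaces : ∀ w ∈ S, w ≠ v₀ →
      (((3 : ℕ) : 𝓞 ℚ) ∉ w.asIdeal ∧ Nat.card (nsmulAddMonoidHom 3 :
          (W'.baseChange (w.adicCompletion ℚ)).toAffine.Point →+ _).ker = 1) ∨
      (W.HasSplitMultiplicativeReductionAt w ∧ W'.HasSplitMultiplicativeReductionAt w ∧
        Nat.card (nsmulAddMonoidHom 3 :
          (W.baseChange (w.adicCompletion ℚ)).toAffine.Point →+ _).ker ≤ 3) ∨
      (W.HasMultiplicativeReductionAt w ∧ W'.HasMultiplicativeReductionAt w ∧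
        (∃ r : w.adicCompletion ℚ, algebraMap ℚ (w.adicCompletion ℚ) (-(W.c₄ / W.c₆)) =
          r ^ 2 * algebraMap ℚ (w.adicCompletion ℚ) (-(W'.c₄ / W'.c₆))) ∧
        (∀ ζ : w.adicCompletion ℚ, ζ ^ 3 = 1 → ζ = 1)) ∨
      (W.HasMultiplicativeReductionAt w ∧
        ¬ IsSquare (algebraMap ℚ (w.adicCompletion ℚ) (-(W.c₄ / W.c₆))) ∧
        W'.HasGoodReductionAt w ∧ ((3 : ℕ) : 𝓞 ℚ) ∉ w.asIdeal) ∨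
      (W.HasGoodReductionAt w ∧ W'.HasMultiplicativeReductionAt w ∧
        ¬ IsSquare (algebraMap ℚ (w.adicCompletion ℚ) (-(W'.c₄ / W'.c₆))) ∧
        ((3 : ℕ) : 𝓞 ℚ) ∉ w.asIdeal) ∨
      (1 < w.valuation ℚ W.j ∧ 1 < w.valuation ℚ W'.j ∧
        (∃ r : w.adicCompletion ℚ, algebraMap ℚ (w.adicCompletion ℚ) (-(W.c₄ / W.c₆)) =
          r ^ 2 * algebraMap ℚ (w.adicCompletion ℚ) (-(W'.c₄ / W'.c₆))) ∧
        (∀ ζ : w.adicCompletion ℚ, ζ ^ 3 = 1 → ζ = 1)) ∨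
      (W.HasAdditiveReductionAt w ∧ W'.HasAdditiveReductionAt w ∧ ((3 : ℕ) : 𝓞 ℚ) ∉ w.asIdeal ∧
        Nat.card (nsmulAddMonoidHom 3 :
          (W'.baseChange (w.adicCompletion ℚ)).toAffine.Point →+ _).ker = 3))
    (hcard : Nat.card (nsmulAddMonoidHom 3 :
      (W.baseChange (v₀.adicCompletion ℚ)).toAffine.Point →+ _).ker = 3)
    (hcard' : Nat.card (nsmulAddMonoidHom 3 :
      (W'.baseChange (v₀.adicCompletion ℚ)).toAffine.Point →+ _).ker = 3)
    (M : WeierstrassCurve (v₀.adicCompletionIntegers ℚ)) (C : VariableChange (v₀.adicCompletion ℚ))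
    (hC : C • W.baseChange (v₀.adicCompletion ℚ) =
      M.map (algebraMap (v₀.adicCompletionIntegers ℚ) (v₀.adicCompletion ℚ)))
    (x₀ y₀ a : IsLocalRing.ResidueField (v₀.adicCompletionIntegers ℚ))
    (hcusp : M.map (IsLocalRing.residue (v₀.adicCompletionIntegers ℚ)) = singularModel x₀ y₀ a a)
    {a₀ b₀ : v₀.adicCompletionIntegers ℚ}
    (hns₀ : (M.map (IsLocalRing.residue (v₀.adicCompletionIntegers ℚ))).toAffine.Nonsingular
      (IsLocalRing.residue (v₀.adicCompletionIntegers ℚ) a₀)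
      (IsLocalRing.residue (v₀.adicCompletionIntegers ℚ) b₀))
    (hm : ((M.map (algebraMap (v₀.adicCompletionIntegers ℚ) (v₀.adicCompletion ℚ))).baseChange
        (AlgebraicClosure (v₀.adicCompletion ℚ))).toAffine.Nonsingular
      (algebraMap (v₀.adicCompletionIntegers ℚ) (AlgebraicClosure (v₀.adicCompletion ℚ)) a₀)
      (algebraMap (v₀.adicCompletionIntegers ℚ) (AlgebraicClosure (v₀.adicCompletion ℚ)) b₀))
    (h3 : (3 : ℤ) • (Affine.Point.some _ _ hm :
      ((M.map (algebraMap (v₀.adicCompletionIntegers ℚ) (v₀.adicCompletion ℚ))).baseChange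
        (AlgebraicClosure (v₀.adicCompletion ℚ))).toAffine.Point) = 0)
    (hgood' : W'.HasGoodReductionAt v₀) :
    ∃ c : W.sha, c ≠ 0 ∧ 3 • c = 0 :=
  haveI : Fact (Nat.Prime 3) := ⟨Nat.prime_three⟩
  exists_sha_ne_zero_of_congr_of_identityComponent_of_hasGoodReductionAt_of_rank_two_rat W W' θ hθ S hS
    hfin hcop hrank v₀ hv₀
    (fun v hv hne ↦ TwoLagrangianLines.relIndex_map_selmerLocalKer_eq_one_of_kind₇ W W' hU hU2
      (by norm_num) θ hθ (hplaces v hv hne))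
    hcard hcard' M C hC x₀ y₀ a hcusp hns₀ hm h3 hgood'

end Summit.BirchSwinnertonDyer.Rank1Residual.GaloisImage.TwistedWitness

end
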